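import Literature.NumberTheory.LFunctions.WeilThreePrimeSliver
import HarnessLib

/-!
# The sliver loss: comparing the `M`- and `N`-prime-power forms of Weil's functional on a window

Topic `Literature/NumberTheory/LFunctions`.  For a test function `g` supported in `[-c, c]` with
`c ≤ (log (N+1))/2`, Weil's quadratic functional is the finite-prime analytic form `E_N(g)`
(`weilQuadratic_re_eq_weilFinitePrimeQuadratic`, `WeilFinitePrimeQuadratic.lean`): only the prime powers
`n ≤ N` are visible.  For `M ≤ N` the two truncations differ by the spikes `M < n ≤ N`:

  `E_N(g) − E_M(g) = −Σ_{M < n ≤ N} (Λ(n)/√n) · Re(k(log n) + k(−log n))`,  `k = g ⋆ g̃`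

(**`weilFinitePrimeQuadratic_sub_eq_neg_sum`**, Mellin inversion spike by spike).  When moreover
`c < log (M+1)`, every such shift `log n > c` meets the window only in a SLIVER, where
`|k(log n) + k(−log n)| ≤ ‖g‖₂²` (`norm_weilConv_weilReflect_add_neg_le`, `WeilThreePrimeSliver.lean`), so

  **`|E_N(g) − E_M(g)| ≤ ℓ(M, N) · ‖g‖₂²`,  `ℓ(M, N) := Σ_{M < n ≤ N} Λ(n)/√n`**  (the SLIVER LOSS)

(`abs_weilFinitePrimeQuadratic_sub_le`; one-sided `weilFinitePrimeQuadratic_sub_sliver_le`, and against Weil's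
functional itself `weilFinitePrimeQuadratic_sub_sliver_le_weilQuadratic_re`).  Consequence
(**`weilPositivityOn_of_finitePrimeQuadratic_ge`**): a lower bound `E_M(g) ≥ β ‖g‖₂²` on the window `[-c, c]`
with `β ≥ ℓ(M, N)`, `c < log (M+1)`, `c ≤ (log (N+1))/2` yields Weil positivity on `[-c, c]`.  The case
`M = 3, N = 4` (`ℓ = (log 2)/2`, `weilSliverLoss_three_four`) is `WeilThreePrimeSliver.lean`; the next windows cost
`ℓ(3, 5) = (log 2)/2 + (log 5)/√5` (`weilSliverLoss_three_five`, window up to `(log 6)/2`) and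
`ℓ(3, 8) = (log 2)/2 + (log 5)/√5 + (log 7)/√7 + (log 2)/√8` (`weilSliverLoss_three_eight`, up to `(log 9)/2 = log 3`).
All proved; no named facts.

## References
* E. Bombieri, *Remarks on Weil's quadratic functional in the theory of prime numbers I*, Rend. Mat. Acc. Lincei (9) 11
  (2000), §4 Lemma 2, Thm 2 (explicit formula). [Bombieri2000]
* H. Yoshida, *On Hermitian forms attached to zeta functions*, Adv. Stud. Pure Math. 21 (1992), §2 eq. (2.1). [Yoshida1992]
-/

noncomputable section

open Complex Filter Set MeasureTheory
open scoped Real Topology ComplexConjugate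

namespace Literature.NumberTheory.LFunctions

variable {g : ℝ → ℂ}

/-! ## The sliver loss `ℓ(M, N) = Σ_{M < n ≤ N} Λ(n)/√n` -/

/-- The sliver loss `ℓ(M, N) := Σ_{M < n ≤ N} Λ(n)/√n`: the total weight of the prime-power spikes visible on a
window `c ≤ (log (N+1))/2` but absent from the `M`-form. [cite: Yoshida1992, §2 eq. (2.1) (the p^m-terms with M < p^m ≤ N)] -/
def weilSliverLoss (M N : ℕ) : ℝ :=
  ∑ n ∈ Finset.Ioc M N, (ArithmeticFunction.vonMangoldt n : ℝ) / Real.sqrt (n : ℝ)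

/-- `ℓ(M, N) ≥ 0`. [folklore] -/
theorem weilSliverLoss_nonneg (M N : ℕ) : 0 ≤ weilSliverLoss M N :=
  Finset.sum_nonneg fun _ _ ↦ div_nonneg ArithmeticFunction.vonMangoldt_nonneg (Real.sqrt_nonneg _)

/-- `ℓ(M, M) = 0`. [folklore] -/
@[simp] theorem weilSliverLoss_self (M : ℕ) : weilSliverLoss M M = 0 := by
  simp [weilSliverLoss]

/-- `ℓ(M, N+1) = ℓ(M, N) + Λ(N+1)/√(N+1)` for `M ≤ N`. [folklore] -/
theorem weilSliverLoss_succ {M N : ℕ} (hMN : M ≤ N) :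
    weilSliverLoss M (N + 1) = weilSliverLoss M N +
      (ArithmeticFunction.vonMangoldt (N + 1) : ℝ) / Real.sqrt ((N + 1 : ℕ) : ℝ) := by
  unfold weilSliverLoss
  rw [Finset.sum_Ioc_succ_top hMN]

/-! ## One more prime power: `E_{N+1} − E_N` -/

/-- `ρ_{N+1}(t) = ρ_N(t) + (Λ(N+1)/√(N+1)) · 2cos(t log (N+1))`. [folklore] -/
theorem weilPrimeRipple_succ (N : ℕ) (t : ℝ) :
    weilPrimeRipple (N + 1) t = weilPrimeRipple N t +
      (ArithmeticFunction.vonMangoldt (N + 1) : ℝ) / Real.sqrt ((N + 1 : ℕ) : ℝ) *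
        (2 * Real.cos (t * Real.log ((N + 1 : ℕ) : ℝ))) := by
  unfold weilPrimeRipple
  rw [Finset.sum_range_succ]

/-- `w_{N+1}(t) = w_N(t) − (Λ(N+1)/√(N+1)) · 2cos(t log (N+1))`. [folklore] -/
theorem weilFinitePrimeWeight_succ (N : ℕ) (t : ℝ) :
    weilFinitePrimeWeight (N + 1) t = weilFinitePrimeWeight N t -
      (ArithmeticFunction.vonMangoldt (N + 1) : ℝ) / Real.sqrt ((N + 1 : ℕ) : ℝ) *
        (2 * Real.cos (t * Real.log ((N + 1 : ℕ) : ℝ))) := by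
  unfold weilFinitePrimeWeight
  rw [weilPrimeRipple_succ]
  ring

/-- **The spike of `n = N+1` in analytic form**:
`E_{N+1}(g) − E_N(g) = −(Λ(N+1)/√(N+1)) · Re(k(log (N+1)) + k(−log (N+1)))`, `k = g ⋆ g̃`
(Mellin inversion `k(x) + k(−x) = (1/2π)∫|ĝ(1/2+it)|² 2cos(tx) dt`). [cite: Yoshida1992, §2 eq. (2.1) (the p^m = N+1 term)] -/
theorem weilFinitePrimeQuadratic_succ_sub (hg : IsWeilTest g) (N : ℕ) :
    weilFinitePrimeQuadratic (N + 1) g - weilFinitePrimeQuadratic N g =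
      -((ArithmeticFunction.vonMangoldt (N + 1) : ℝ) / Real.sqrt ((N + 1 : ℕ) : ℝ)) *
        (weilConv g (weilReflect g) (Real.log ((N + 1 : ℕ) : ℝ)) +
          weilConv g (weilReflect g) (-Real.log ((N + 1 : ℕ) : ℝ))).re := by
  have hIN := integrable_norm_sq_weilMellin_mul_weilFinitePrimeWeight hg N
  have hIc : Integrable fun t : ℝ ↦
      ‖weilMellin g (1 / 2 + t * I)‖ ^ 2 * (2 * Real.cos (t * Real.log ((N + 1 : ℕ) : ℝ))) :=
    integrable_norm_sq_weilMellin_mul_two_cos hg (Real.log ((N + 1 : ℕ) : ℝ))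
  have hsplit : ∫ t : ℝ, ‖weilMellin g (1 / 2 + t * I)‖ ^ 2 * weilFinitePrimeWeight (N + 1) t =
      (∫ t : ℝ, ‖weilMellin g (1 / 2 + t * I)‖ ^ 2 * weilFinitePrimeWeight N t) -
        (ArithmeticFunction.vonMangoldt (N + 1) : ℝ) / Real.sqrt ((N + 1 : ℕ) : ℝ) *
          ∫ t : ℝ, ‖weilMellin g (1 / 2 + t * I)‖ ^ 2 * (2 * Real.cos (t * Real.log ((N + 1 : ℕ) : ℝ))) := by
    have e : (fun t : ℝ ↦ ‖weilMellin g (1 / 2 + t * I)‖ ^ 2 * weilFinitePrimeWeight (N + 1) t) =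
        fun t : ℝ ↦ ‖weilMellin g (1 / 2 + t * I)‖ ^ 2 * weilFinitePrimeWeight N t -
          (ArithmeticFunction.vonMangoldt (N + 1) : ℝ) / Real.sqrt ((N + 1 : ℕ) : ℝ) *
            (‖weilMellin g (1 / 2 + t * I)‖ ^ 2 * (2 * Real.cos (t * Real.log ((N + 1 : ℕ) : ℝ)))) := by
      funext t
      rw [weilFinitePrimeWeight_succ]
      ring
    rw [e, integral_sub hIN (hIc.const_mul _), integral_const_mul]
  have hk := weilConv_weilReflect_add_eq_integral hg (Real.log ((N + 1 : ℕ) : ℝ))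
  have hre : (weilConv g (weilReflect g) (Real.log ((N + 1 : ℕ) : ℝ)) +
      weilConv g (weilReflect g) (-Real.log ((N + 1 : ℕ) : ℝ))).re =
      1 / (2 * π) * ∫ t : ℝ, ‖weilMellin g (1 / 2 + t * I)‖ ^ 2 *
        (2 * Real.cos (t * Real.log ((N + 1 : ℕ) : ℝ))) := by
    rw [hk, show (1 / (2 * π) : ℂ) = ((1 / (2 * π) : ℝ) : ℂ) by push_cast; ring, ← Complex.ofReal_mul,
      Complex.ofReal_re]
  unfold weilFinitePrimeQuadratic
  rw [hsplit, hre]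
  ring

/-! ## `E_N − E_M` as the sum of the spikes `M < n ≤ N` -/

/-- **`E_N(g) − E_M(g) = −Σ_{M < n ≤ N} (Λ(n)/√n) · Re(k(log n) + k(−log n))`** for `M ≤ N` and any test
function `g` (no support hypothesis). [cite: Yoshida1992, §2 eq. (2.1) (the p^m-terms with M < p^m ≤ N)] -/
theorem weilFinitePrimeQuadratic_sub_eq_neg_sum (hg : IsWeilTest g) {M N : ℕ} (hMN : M ≤ N) :
    weilFinitePrimeQuadratic N g - weilFinitePrimeQuadratic M g =
      -∑ n ∈ Finset.Ioc M N, (ArithmeticFunction.vonMangoldt n : ℝ) / Real.sqrt (n : ℝ) *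
        (weilConv g (weilReflect g) (Real.log (n : ℝ)) + weilConv g (weilReflect g) (-Real.log (n : ℝ))).re := by
  induction N, hMN using Nat.le_induction with
  | base => simp
  | succ N hMN ih =>
    rw [Finset.sum_Ioc_succ_top hMN,
      show weilFinitePrimeQuadratic (N + 1) g - weilFinitePrimeQuadratic M g =
          (weilFinitePrimeQuadratic (N + 1) g - weilFinitePrimeQuadratic N g) +
            (weilFinitePrimeQuadratic N g - weilFinitePrimeQuadratic M g) by ring,
      weilFinitePrimeQuadratic_succ_sub hg N, ih]
    ring

/-! ## The sliver bound -/

/-- **Sliver bound**: for a test function `g` with `tsupport g ⊆ [-c, c]`, `c < log (M+1)` and `M ≤ N`,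
`|E_N(g) − E_M(g)| ≤ ℓ(M, N) · ‖g‖₂²` — each shift `log n`, `n > M`, exceeds `c`, so `|k(log n) + k(−log n)| ≤ ‖g‖₂²`.
[cite: Yoshida1992, §2 eq. (2.1) (the p^m-terms with M < p^m ≤ N); Bombieri2000, §4 Lemma 2] -/
theorem abs_weilFinitePrimeQuadratic_sub_le (hg : IsWeilTest g) {c : ℝ} (hsupp : tsupport g ⊆ Icc (-c) c)
    {M N : ℕ} (hMN : M ≤ N) (hc : c < Real.log ((M : ℝ) + 1)) :
    |weilFinitePrimeQuadratic N g - weilFinitePrimeQuadratic M g| ≤ weilSliverLoss M N * weilNorm2Sq g := by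
  rw [weilFinitePrimeQuadratic_sub_eq_neg_sum hg hMN, abs_neg, weilSliverLoss, Finset.sum_mul]
  refine (Finset.abs_sum_le_sum_abs _ _).trans (Finset.sum_le_sum fun n hn ↦ ?_)
  have hn : M + 1 ≤ n := (Finset.mem_Ioc.mp hn).1
  have hcn : c < Real.log (n : ℝ) := by
    refine hc.trans_le (Real.log_le_log (by positivity) ?_)
    exact_mod_cast hn
  have hL : 0 ≤ (ArithmeticFunction.vonMangoldt n : ℝ) / Real.sqrt (n : ℝ) :=
    div_nonneg ArithmeticFunction.vonMangoldt_nonneg (Real.sqrt_nonneg _)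
  have hk := norm_weilConv_weilReflect_add_neg_le hg hsupp hcn
  have hre := Complex.abs_re_le_norm
    (weilConv g (weilReflect g) (Real.log (n : ℝ)) + weilConv g (weilReflect g) (-Real.log (n : ℝ)))
  rw [abs_mul, abs_of_nonneg hL]
  unfold weilNorm2Sq
  exact mul_le_mul_of_nonneg_left (hre.trans hk) hL

/-- **One-sided sliver bound**: `E_M(g) − ℓ(M, N) · ‖g‖₂² ≤ E_N(g)` for `tsupport g ⊆ [-c, c]`, `c < log (M+1)`,
`M ≤ N`. [cite: Yoshida1992, §2 eq. (2.1) (the p^m-terms with M < p^m ≤ N); Bombieri2000, §4 Lemma 2] -/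
theorem weilFinitePrimeQuadratic_sub_sliver_le (hg : IsWeilTest g) {c : ℝ} (hsupp : tsupport g ⊆ Icc (-c) c)
    {M N : ℕ} (hMN : M ≤ N) (hc : c < Real.log ((M : ℝ) + 1)) :
    weilFinitePrimeQuadratic M g - weilSliverLoss M N * weilNorm2Sq g ≤ weilFinitePrimeQuadratic N g := by
  have h := abs_weilFinitePrimeQuadratic_sub_le hg hsupp hMN hc
  rw [abs_le] at h
  linarith [h.1]

/-- **Against Weil's functional**: for `tsupport g ⊆ [-c, c]` with `c < log (M+1)` and `c ≤ (log (N+1))/2`, `M ≤ N`: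
`E_M(g) − ℓ(M, N) · ‖g‖₂² ≤ Re Q(g)`.  The `M`-form certifies the true functional up to the sliver loss.
[cite: Yoshida1992, §2 eq. (2.1) (the p^m-terms with M < p^m ≤ N); Bombieri2000, §4 Lemma 2, Thm 2] -/
theorem weilFinitePrimeQuadratic_sub_sliver_le_weilQuadratic_re (hg : IsWeilTest g) {c : ℝ}
    (hsupp : tsupport g ⊆ Icc (-c) c) {M N : ℕ} (hMN : M ≤ N) (hcM : c < Real.log ((M : ℝ) + 1))
    (hcN : c ≤ Real.log ((N : ℝ) + 1) / 2) :
    weilFinitePrimeQuadratic M g - weilSliverLoss M N * weilNorm2Sq g ≤ (weilQuadratic g).re := by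
  have hsupp' : tsupport g ⊆ Icc (-(Real.log ((N : ℝ) + 1) / 2)) (Real.log ((N : ℝ) + 1) / 2) :=
    hsupp.trans (Icc_subset_Icc (by linarith) hcN)
  rw [weilQuadratic_re_eq_weilFinitePrimeQuadratic hg N hsupp']
  exact weilFinitePrimeQuadratic_sub_sliver_le hg hsupp hMN hcM

/-- **Positivity transfer through the sliver loss**: if the `M`-form satisfies `β · ‖g‖₂² ≤ E_M(g)` for every test
function supported in `[-c, c]`, with `β ≥ ℓ(M, N)`, `c < log (M+1)` and `c ≤ (log (N+1))/2`, then Weil's functional is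
non-negative on `[-c, c]`. [cite: Yoshida1992, §2 eq. (2.1); Bombieri2000, §4 Lemma 2, Thm 2] -/
theorem weilPositivityOn_of_finitePrimeQuadratic_ge (c : ℝ) {M N : ℕ} (hMN : M ≤ N)
    (hcM : c < Real.log ((M : ℝ) + 1)) (hcN : c ≤ Real.log ((N : ℝ) + 1) / 2) {β : ℝ}
    (hβ : weilSliverLoss M N ≤ β)
    (h : ∀ g : ℝ → ℂ, IsWeilTest g → tsupport g ⊆ Icc (-c) c → β * weilNorm2Sq g ≤ weilFinitePrimeQuadratic M g) :
    WeilPositivityOn c := by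
  intro g hg hsupp
  have h1 := weilFinitePrimeQuadratic_sub_sliver_le_weilQuadratic_re hg hsupp hMN hcM hcN
  have h2 := h g hg hsupp
  have hn : 0 ≤ weilNorm2Sq g := integral_nonneg fun _ ↦ by positivity
  have h3 : weilSliverLoss M N * weilNorm2Sq g ≤ β * weilNorm2Sq g := mul_le_mul_of_nonneg_right hβ hn
  linarith

/-! ## The first sliver losses beyond the two-prime form `E₂₃ = E_3` -/

/-- `Λ(5) = log 5`. [folklore] -/
theorem vonMangoldt_five : (ArithmeticFunction.vonMangoldt 5 : ℝ) = Real.log 5 := by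
  rw [ArithmeticFunction.vonMangoldt_apply_prime Nat.prime_five]; norm_num

/-- `Λ(6) = 0` (`6 = 2·3` is not a prime power). [folklore] -/
theorem vonMangoldt_six : (ArithmeticFunction.vonMangoldt 6 : ℝ) = 0 := by
  rw [ArithmeticFunction.vonMangoldt_eq_zero_iff, isPrimePow_nat_iff]
  rintro ⟨p, k, hp, hk, hpk⟩
  have h26 : (2 : ℕ) ∣ p ^ k := by rw [hpk]; norm_num
  have h36 : (3 : ℕ) ∣ p ^ k := by rw [hpk]; norm_num
  have h2 := (Nat.prime_dvd_prime_iff_eq Nat.prime_two hp).mp (Nat.prime_two.dvd_of_dvd_pow h26)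
  have h3 := (Nat.prime_dvd_prime_iff_eq Nat.prime_three hp).mp (Nat.prime_three.dvd_of_dvd_pow h36)
  omega

/-- `Λ(7) = log 7`. [folklore] -/
theorem vonMangoldt_seven : (ArithmeticFunction.vonMangoldt 7 : ℝ) = Real.log 7 := by
  rw [ArithmeticFunction.vonMangoldt_apply_prime Nat.prime_seven]; norm_num

/-- `Λ(8) = log 2`. [folklore] -/
theorem vonMangoldt_eight : (ArithmeticFunction.vonMangoldt 8 : ℝ) = Real.log 2 := by
  rw [show (8 : ℕ) = 2 ^ 3 by norm_num, ArithmeticFunction.vonMangoldt_apply_pow three_ne_zero,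
    ArithmeticFunction.vonMangoldt_apply_prime Nat.prime_two]
  norm_num

/-- `√4 = 2`. [folklore] -/
theorem sqrt_four_eq_two : Real.sqrt ((4 : ℕ) : ℝ) = 2 := by
  rw [show ((4 : ℕ) : ℝ) = 2 ^ 2 by norm_num, Real.sqrt_sq (by norm_num)]

/-- `ℓ(3, 4) = (log 2)/2`: the window `((log 4)/2, (log 5)/2]` (`WeilThreePrimeSliver.lean`). [folklore] -/
theorem weilSliverLoss_three_four : weilSliverLoss 3 4 = Real.log 2 / 2 := by
  rw [weilSliverLoss_succ le_rfl, weilSliverLoss_self, zero_add,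
    show (3 + 1 : ℕ) = 4 from rfl, vonMangoldt_four, sqrt_four_eq_two]

/-- `ℓ(3, 5) = (log 2)/2 + (log 5)/√5`: the window `((log 5)/2, (log 6)/2]` (and, `Λ(6) = 0`, up to `(log 7)/2`). [folklore] -/
theorem weilSliverLoss_three_five :
    weilSliverLoss 3 5 = Real.log 2 / 2 + Real.log 5 / Real.sqrt 5 := by
  rw [weilSliverLoss_succ (by norm_num), weilSliverLoss_three_four, show (4 + 1 : ℕ) = 5 from rfl,
    vonMangoldt_five]
  norm_num

/-- `ℓ(3, 6) = ℓ(3, 5)`. [folklore] -/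
theorem weilSliverLoss_three_six : weilSliverLoss 3 6 = weilSliverLoss 3 5 := by
  rw [weilSliverLoss_succ (by norm_num), show (5 + 1 : ℕ) = 6 from rfl, vonMangoldt_six]
  simp

/-- `ℓ(3, 7) = (log 2)/2 + (log 5)/√5 + (log 7)/√7 ≈ 1.802`: the window `((log 7)/2, (log 8)/2]`, which contains `c = 1`
(`log 8 = 3 log 2 > 2`); cheaper than `ℓ(3, 8)` by `(log 2)/√8`. [folklore] -/
theorem weilSliverLoss_three_seven :
    weilSliverLoss 3 7 = Real.log 2 / 2 + Real.log 5 / Real.sqrt 5 + Real.log 7 / Real.sqrt 7 := by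
  rw [weilSliverLoss_succ (by norm_num), show (6 + 1 : ℕ) = 7 from rfl, vonMangoldt_seven,
    weilSliverLoss_three_six, weilSliverLoss_three_five]
  norm_num

/-- The window `c = 1` is served by `N = 7`: `1 ≤ (log 8)/2` and `1 < log 4`. [folklore] -/
theorem one_le_log_eight_half_and_lt_log_four :
    (1 : ℝ) ≤ Real.log (((7 : ℕ) : ℝ) + 1) / 2 ∧ (1 : ℝ) < Real.log 4 := by
  have h2 := Real.log_two_gt_d9
  have h8 : Real.log (((7 : ℕ) : ℝ) + 1) = 3 * Real.log 2 := by
    rw [show (((7 : ℕ) : ℝ) + 1) = (2 : ℝ) ^ 3 by norm_num, Real.log_pow]; norm_num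
  have h4 : Real.log 4 = 2 * Real.log 2 := by
    rw [show (4 : ℝ) = (2 : ℝ) ^ 2 by norm_num, Real.log_pow]; norm_num
  rw [h8, h4]
  constructor <;> linarith

/-- `ℓ(3, 8) = (log 2)/2 + (log 5)/√5 + (log 7)/√7 + (log 2)/√8`: the window `((log 8)/2, (log 9)/2 = log 3]`. [folklore] -/
theorem weilSliverLoss_three_eight :
    weilSliverLoss 3 8 =
      Real.log 2 / 2 + Real.log 5 / Real.sqrt 5 + Real.log 7 / Real.sqrt 7 + Real.log 2 / Real.sqrt 8 := by
  rw [weilSliverLoss_succ (by norm_num), show (7 + 1 : ℕ) = 8 from rfl, vonMangoldt_eight,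
    weilSliverLoss_succ (by norm_num), show (6 + 1 : ℕ) = 7 from rfl, vonMangoldt_seven,
    weilSliverLoss_three_six, weilSliverLoss_three_five]
  norm_num

/-! ### Rational enclosures of the sliver losses

What a user of `weilPositivityOn_of_finitePrimeQuadratic_ge` (hypothesis `weilSliverLoss M N ≤ β`) or of a
two-prime-certificate bridge (`β₂₃ − ℓ(3, N)`) actually needs: decimal upper bounds, each correct to `< 10⁻⁶`. -/

/-- `(log 5)/√5 ≤ 0.7197626` (true value `0.71976252…`). [folklore] -/
theorem log_five_div_sqrt_five_le : Real.log 5 / Real.sqrt 5 ≤ 0.7197626 := by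
  have h5 := Real.log_five_lt_d9
  have hs : (2.2360679 : ℝ) < Real.sqrt 5 := Real.lt_sqrt_of_sq_lt (by norm_num)
  rw [div_le_iff₀ (by positivity)]
  linarith

/-- `(log 7)/√7 ≤ 0.7354854` (true value `0.73548490…`; `log 7 < 1.945911` from eight terms of the series
for `log (7/8)`). [folklore] -/
theorem log_seven_div_sqrt_seven_le : Real.log 7 / Real.sqrt 7 ≤ 0.7354854 := by
  have h7 : Real.log 7 < 1.945911 := by
    have h := Real.abs_log_sub_add_sum_range_le (show |(1 / 8 : ℝ)| < 1 by norm_num) 8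
    have h2u := Real.log_two_lt_d9
    have e : Real.log (1 - 1 / 8 : ℝ) = Real.log 7 - 3 * Real.log 2 := by
      rw [show (1 - 1 / 8 : ℝ) = 7 / 8 by norm_num, Real.log_div (by norm_num) (by norm_num),
        show (8 : ℝ) = 2 ^ 3 by norm_num, Real.log_pow]
      push_cast; ring
    rw [e] at h
    norm_num [Finset.sum_range_succ] at h
    rw [abs_le] at h
    linarith [h.1, h.2]
  have hs : (2.6457513 : ℝ) < Real.sqrt 7 := Real.lt_sqrt_of_sq_lt (by norm_num)
  rw [div_le_iff₀ (by positivity)]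
  linarith

/-- `(log 2)/√8 ≤ 0.2450646` (true value `0.24506453…`). [folklore] -/
theorem log_two_div_sqrt_eight_le : Real.log 2 / Real.sqrt 8 ≤ 0.2450646 := by
  have h2 := Real.log_two_lt_d9
  have hs : (2.8284271 : ℝ) < Real.sqrt 8 := Real.lt_sqrt_of_sq_lt (by norm_num)
  rw [div_le_iff₀ (by positivity)]
  linarith

/-- `ℓ(3, 4) = (log 2)/2 ≤ 0.3465736` (true `0.34657359…`). [folklore] -/
theorem weilSliverLoss_three_four_le : weilSliverLoss 3 4 ≤ 0.3465736 := by
  rw [weilSliverLoss_three_four]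
  linarith [Real.log_two_lt_d9]

/-- `ℓ(3, 5) ≤ 1.0663362` (true `1.06633610…`). [folklore] -/
theorem weilSliverLoss_three_five_le : weilSliverLoss 3 5 ≤ 1.0663362 := by
  rw [weilSliverLoss_three_five]
  linarith [Real.log_two_lt_d9, log_five_div_sqrt_five_le]

/-- `ℓ(3, 6) ≤ 1.0663362`. [folklore] -/
theorem weilSliverLoss_three_six_le : weilSliverLoss 3 6 ≤ 1.0663362 := by
  rw [weilSliverLoss_three_six]; exact weilSliverLoss_three_five_le

/-- `ℓ(3, 7) ≤ 1.8018216` (true `1.80182100…`): a two-prime certificate serving the rung `c = 1` needs level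
`β₂₃ > 1.8018216 + β`. [folklore] -/
theorem weilSliverLoss_three_seven_le : weilSliverLoss 3 7 ≤ 1.8018216 := by
  rw [weilSliverLoss_three_seven]
  linarith [Real.log_two_lt_d9, log_five_div_sqrt_five_le, log_seven_div_sqrt_seven_le]

/-- `ℓ(3, 8) ≤ 2.0468862` (true `2.04688554…`): the rung `c = log 3`. [folklore] -/
theorem weilSliverLoss_three_eight_le : weilSliverLoss 3 8 ≤ 2.0468862 := by
  rw [weilSliverLoss_three_eight]
  linarith [Real.log_two_lt_d9, log_five_div_sqrt_five_le, log_seven_div_sqrt_seven_le,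
    log_two_div_sqrt_eight_le]

/-- **The two-prime form against Weil's functional on any window below `log 4`**: for `tsupport g ⊆ [-c, c]`,
`c < log 4`, `c ≤ (log (N+1))/2`, `3 ≤ N`: `E₂₃(g) − ℓ(3, N) · ‖g‖₂² ≤ Re Q(g)`. [cite: Yoshida1992, §2 eq. (2.1); Bombieri2000, §4 Lemma 2, Thm 2] -/
theorem weilTwoPrimeQuadratic_sub_sliverLoss_le_weilQuadratic_re (hg : IsWeilTest g) {c : ℝ}
    (hsupp : tsupport g ⊆ Icc (-c) c) {N : ℕ} (hN : 3 ≤ N) (hc4 : c < Real.log 4)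
    (hcN : c ≤ Real.log ((N : ℝ) + 1) / 2) :
    weilTwoPrimeQuadratic g - weilSliverLoss 3 N * weilNorm2Sq g ≤ (weilQuadratic g).re := by
  rw [← weilFinitePrimeQuadratic_three]
  exact weilFinitePrimeQuadratic_sub_sliver_le_weilQuadratic_re hg hsupp hN
    (by norm_num; exact hc4) hcN

end Literature.NumberTheory.LFunctions

end
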